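import Literature.Probability.Percolation.SlabCircuitLink
import HarnessLib

/-!
# Newman–Tassion–Wu 2017, §3.4/§3.7 — Lemma 3.11, Lemma 3.13 (i) and (3.60) with (H38) in the REPAIRED
# window, and (H38) DISCHARGED

Topic: `Literature/Probability/Percolation`.  The tree's `SlabRSWLemma311.lean` derives Lemma 3.11,
Lemma 3.13 (i) and (3.60) from the gluing-layer inputs (H38), (H310), (H39), (H317), with (H38) stated for
the window `R_i(z) = z + [0,3n] × [-m,m]` of NTW's text.  In the slab the provable form of Theorem 3.8 joins
the minimal circuits inside the larger window `linkWindow z n i ⊇ R_i(z) ∪ A_{m,n}(z) ∪ A_{m,n}(z+3n eᵢ)`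
(`SlabCircuitLink.lean`, `h38_window`; p1's region-gap remark); since Lemma 3.11 uses the edge event only
through the link event of the block structure `circuitBlockCore` (window `z + B_{6n}` ⊇ `linkWindow`),
the three results hold verbatim with (H38) restated for `linkEvent'` — the proofs below are those of
`SlabRSWLemma311.lean` with `linkEvent'_subset_link` in place of `linkEvent_subset_link`:

* `lemma311_of_window`, `lemma313_i_of_window`, `h360_of_window`;
* **`h360_of_three_inputs`** — (3.60) at `p_c(S_k)` from (H310), (H39), (H317) only, (H38) being
  discharged by `h38_window`.

## Sources

* C. M. Newman, V. Tassion, W. Wu, *Critical percolation and the minimal spanning tree in slabs*,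
  Comm. Pure Appl. Math. 70 (2017) = arXiv:1512.09107: Lemma 3.11, Lemma 3.13, §3.7 (3.60), Theorem 3.8
  [NewmanTassionWu2017].
-/

noncomputable section

namespace Literature.Probability.Percolation

open MeasureTheory LatticeModels Filter Topology

namespace NTW17

variable {k : ℕ}

/-! ## Lemma 3.11 -/

/-- **NTW 2017, Lemma 3.11 (finite criterion for `θ(p) > 0`), from the gluing-layer inputs.**
Fix `k`, `ε > 0` and `m₀ ≥ 1`.  Assume (H38) the `ε-δ` form of Theorem 3.8 (gluing of the minimal
circuits of two annuli at distance `3n` inside the window `R_i(z)`), (H310) Theorem 3.10 (open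
circuits in `A_{λn,2λn}` from `f(2n,n-1) ≥ c`) and (H39) Prop. 3.9 (1) in the high-probability
regime, all uniformly in `p ∈ [ε, 1-ε]` and in the centre.  Then there is `c₁ > 0` such that for
every `p ∈ [ε, 1-ε]` and `m ≥ m₀`: `f_p(2m, m-1) ≥ 1 - c₁ ⟹ θ_{S_k}(p) > 0`.
Proof = NTW's: (3.76) one application of (H39) with `j = 3·2^ℓ·λ` makes all needed long crossings
`≥ 1 - η`; (3.75) + (3.77) (`real_circuitAround_amplify`) make `P(𝒜_{m, λ2^ℓ m}(z)) ≥ 1 - (1-c')^ℓ`;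
(H38) then bounds the edge events of the block structure `circuitBlockCore` below by `1 - η₀/2`, and
the Claim (`exists_eta_blockCore`) gives `θ > 0`.
[cite: NewmanTassionWu2017, Lemma 3.11 (and its proof, (3.74)–(3.77))] -/
theorem lemma311_of_window {ε : ℝ} (hε : 0 < ε) {m₀ : ℕ} (hm₀ : 1 ≤ m₀)
    (h38 : ∀ η : ℝ, 0 < η → ∃ δ : ℝ, 0 < δ ∧ ∀ p : unitInterval, ε ≤ (p : ℝ) → (p : ℝ) ≤ 1 - ε →
      ∀ m n : ℕ, m₀ ≤ m → m ≤ n → ∀ (z : ℤ × ℤ) (i : Fin 2),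
      1 - δ ≤ crossingProb k p (3 * n) (2 * m) →
      1 - δ ≤ (bondPercolation (slabGraph 3 k) p).real (circuitAround k z m n) →
      1 - δ ≤ (bondPercolation (slabGraph 3 k) p).real (circuitAround k (z + coarseShift (3 * n) i) m n) →
      1 - η ≤ (bondPercolation (slabGraph 3 k) p).real (linkEvent' k z m n i))
    (h310 : ∀ c : ℝ, 0 < c → ∃ lam : ℕ, 1 ≤ lam ∧ ∃ c' : ℝ, 0 < c' ∧ ∀ p : unitInterval,
      ε ≤ (p : ℝ) → (p : ℝ) ≤ 1 - ε → ∀ n : ℕ, m₀ ≤ n → c ≤ crossingProb k p (2 * n) (n - 1) →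
      ∀ z : ℤ × ℤ, c' ≤ (bondPercolation (slabGraph 3 k) p).real (circuitAround k z (lam * n) (2 * (lam * n))))
    (h39 : ∀ η : ℝ, 0 < η → ∀ j : ℕ, 1 ≤ j → ∃ δ : ℝ, 0 < δ ∧ ∀ p : unitInterval,
      ε ≤ (p : ℝ) → (p : ℝ) ≤ 1 - ε → ∀ m : ℕ, m₀ ≤ m →
      1 - δ ≤ crossingProb k p (2 * m) (m - 1) → 1 - η ≤ crossingProb k p (j * m) (m - 1)) :
    ∃ c₁ : ℝ, 0 < c₁ ∧ ∀ p : unitInterval, ε ≤ (p : ℝ) → (p : ℝ) ≤ 1 - ε →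
      ∀ m : ℕ, m₀ ≤ m → 1 - c₁ ≤ crossingProb k p (2 * m) (m - 1) →
        0 < theta (slabGraph 3 k) (slabOrigin 3 k) p := by
  -- the universal `η₀` of the Claim, then `δ₁` from (H38)
  obtain ⟨η₀, hη₀, hClaim⟩ := exists_eta_blockCore
  obtain ⟨δ₁, hδ₁, h38'⟩ := h38 (η₀ / 2) (by linarith)
  -- (3.75): `λ`, `c'` from (H310) with `c = 1/4`
  obtain ⟨lam, hlam, c', hc', h310'⟩ := h310 (1 / 4) (by norm_num)
  set c'' : ℝ := min c' (1 / 2) with hc''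
  have hc''pos : 0 < c'' := lt_min hc' (by norm_num)
  have hc''le : c'' ≤ c' := min_le_left _ _
  -- `ℓ` with `(1 - c'')^ℓ < δ₁`
  obtain ⟨ℓ, hℓ⟩ := exists_pow_lt_of_lt_one hδ₁ (show 1 - c'' < 1 by linarith)
  -- (3.76): `δ₂ = c₁` from (H39) with `η₂ = min δ₁ (3/4)` and `j = 3 · 2^ℓ · λ`
  set η₂ : ℝ := min δ₁ (3 / 4) with hη₂
  have hη₂pos : 0 < η₂ := lt_min hδ₁ (by norm_num)
  have hj : 1 ≤ 3 * 2 ^ ℓ * lam := by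
    have := Nat.one_le_two_pow (n := ℓ)
    calc 1 = 1 * 1 * 1 := by ring
      _ ≤ 3 * 2 ^ ℓ * lam := Nat.mul_le_mul (Nat.mul_le_mul (by norm_num) this) hlam
  obtain ⟨δ₂, hδ₂, h39'⟩ := h39 η₂ hη₂pos (3 * 2 ^ ℓ * lam) hj
  refine ⟨δ₂, hδ₂, fun p hpε hp1 m hm hF0 => ?_⟩
  have hp0 : 0 < (p : ℝ) := lt_of_lt_of_le hε hpε
  -- all the long crossings at once
  have hF : 1 - η₂ ≤ crossingProb k p (3 * 2 ^ ℓ * lam * m) (m - 1) := h39' p hpε hp1 m hm hF0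
  have hF₁ : 1 - δ₁ ≤ crossingProb k p (3 * 2 ^ ℓ * lam * m) (m - 1) := (by
    have : η₂ ≤ δ₁ := min_le_left _ _; linarith)
  have hF₂ : (1 : ℝ) / 4 ≤ crossingProb k p (3 * 2 ^ ℓ * lam * m) (m - 1) := (by
    have : η₂ ≤ 3 / 4 := min_le_right _ _; linarith)
  -- the scales
  set n : ℕ := lam * 2 ^ ℓ * m with hn
  have hm1 : 1 ≤ m := hm₀.trans hm
  have hmn : m ≤ n := by
    rw [hn]
    calc m = 1 * 1 * m := by ring
      _ ≤ lam * 2 ^ ℓ * m := Nat.mul_le_mul_right _ (Nat.mul_le_mul hlam Nat.one_le_two_pow)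
  have hn1 : 1 ≤ n := hm1.trans hmn
  -- (3.75) + (3.77): circuits in `A_{m,n}(w)` with probability `≥ 1 - δ₁`, for every centre `w`
  have hA : ∀ w : ℤ × ℤ, 1 - δ₁ ≤ (bondPercolation (slabGraph 3 k) p).real (circuitAround k w m n) := by
    intro w
    have hamp := real_circuitAround_amplify (k := k) p w (m := m) (lam := lam) (ℓ := ℓ) hlam (c' := c'')
      (fun i hi => ?_)
    · rw [hn]
      have : (1 - c'') ^ ℓ < δ₁ := hℓ
      linarith
    -- (H310) at scale `2^i m`
    have hscale : m₀ ≤ 2 ^ i * m := hm.trans (by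
      calc m = 1 * m := (one_mul m).symm
        _ ≤ 2 ^ i * m := Nat.mul_le_mul_right _ Nat.one_le_two_pow)
    have hcross : (1 : ℝ) / 4 ≤ crossingProb k p (2 * (2 ^ i * m)) (2 ^ i * m - 1) := by
      refine hF₂.trans (crossingProb_mono p ?_ ?_)
      · calc 2 * (2 ^ i * m) = 2 ^ (i + 1) * 1 * m := by ring
          _ ≤ 2 ^ ℓ * lam * m := Nat.mul_le_mul_right _
              (Nat.mul_le_mul (Nat.pow_le_pow_right (by norm_num) hi) hlam)
          _ = 2 ^ ℓ * lam * m := rfl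
          _ ≤ 3 * 2 ^ ℓ * lam * m := by
              rw [mul_assoc 3, mul_assoc 3]; exact Nat.le_mul_of_pos_left _ (by norm_num)
      · have : m ≤ 2 ^ i * m := by
          calc m = 1 * m := (one_mul m).symm
            _ ≤ 2 ^ i * m := Nat.mul_le_mul_right _ Nat.one_le_two_pow
        omega
    have h := h310' p hpε hp1 (2 ^ i * m) hscale hcross w
    have e1 : lam * (2 ^ i * m) = lam * 2 ^ i * m := by ring
    rw [e1] at h
    exact hc''le.trans h
  -- `f(3n, 2m) ≥ 1 - δ₁`
  have hlong : 1 - δ₁ ≤ crossingProb k p (3 * n) (2 * m) := by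
    refine hF₁.trans (crossingProb_mono p (le_of_eq ?_) (by omega))
    rw [hn]; ring
  -- the Claim for the block structure of minimal circuits
  refine hClaim k (circuitBlockCore k m n hn1) p hp0 fun x i => ?_
  have hz := h38' p hpε hp1 m n hm hmn (blockPt (3 * n) x) i hlong (hA _) (hA _)
  have hsub := measureReal_mono (linkEvent'_subset_link (k := k) (m := m) (blockPt (3 * n) x) hn1 i)
    (μ := bondPercolation (slabGraph 3 k) p) (measure_ne_top _ _)
  have : (circuitBlockCore k m n hn1).N = 3 * n := rfl
  rw [this]
  linarith

/-! ## Lemma 3.13 (i) -/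

/-- **NTW 2017, Lemma 3.13, first half: `f_{p_c(S_k)}(2n, n-1) ≤ 1 - c₁` for every `n ≥ m₀`.**
With `ε < p_c(S_k) ≤ 1 - ε` and the inputs of Lemma 3.11 on `[ε, 1-ε]`: the set of `p` with
`f_p(2n,n-1) > 1 - c₁` for some `n ≥ m₀` "is open and does not intersect `[0, p_c(S_k))` (by Lemma
3.11). Thus, `p_c` does not belong to this set".
[cite: NewmanTassionWu2017, Lemma 3.13 (first inequality) and its proof] -/
theorem lemma313_i_of_window {ε : ℝ} (hε : 0 < ε) {m₀ : ℕ} (hm₀ : 1 ≤ m₀)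
    (hεc : ε < criticalProb (slabGraph 3 k) (slabOrigin 3 k))
    (hc1 : criticalProb (slabGraph 3 k) (slabOrigin 3 k) ≤ 1 - ε)
    (h38 : ∀ η : ℝ, 0 < η → ∃ δ : ℝ, 0 < δ ∧ ∀ p : unitInterval, ε ≤ (p : ℝ) → (p : ℝ) ≤ 1 - ε →
      ∀ m n : ℕ, m₀ ≤ m → m ≤ n → ∀ (z : ℤ × ℤ) (i : Fin 2),
      1 - δ ≤ crossingProb k p (3 * n) (2 * m) →
      1 - δ ≤ (bondPercolation (slabGraph 3 k) p).real (circuitAround k z m n) →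
      1 - δ ≤ (bondPercolation (slabGraph 3 k) p).real (circuitAround k (z + coarseShift (3 * n) i) m n) →
      1 - η ≤ (bondPercolation (slabGraph 3 k) p).real (linkEvent' k z m n i))
    (h310 : ∀ c : ℝ, 0 < c → ∃ lam : ℕ, 1 ≤ lam ∧ ∃ c' : ℝ, 0 < c' ∧ ∀ p : unitInterval,
      ε ≤ (p : ℝ) → (p : ℝ) ≤ 1 - ε → ∀ n : ℕ, m₀ ≤ n → c ≤ crossingProb k p (2 * n) (n - 1) →
      ∀ z : ℤ × ℤ, c' ≤ (bondPercolation (slabGraph 3 k) p).real (circuitAround k z (lam * n) (2 * (lam * n))))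
    (h39 : ∀ η : ℝ, 0 < η → ∀ j : ℕ, 1 ≤ j → ∃ δ : ℝ, 0 < δ ∧ ∀ p : unitInterval,
      ε ≤ (p : ℝ) → (p : ℝ) ≤ 1 - ε → ∀ m : ℕ, m₀ ≤ m →
      1 - δ ≤ crossingProb k p (2 * m) (m - 1) → 1 - η ≤ crossingProb k p (j * m) (m - 1)) :
    ∃ c₁ : ℝ, 0 < c₁ ∧ ∀ n : ℕ, m₀ ≤ n →
      crossingProb k (criticalProbIOf (slabGraph 3 k) (slabOrigin 3 k)) (2 * n) (n - 1) ≤ 1 - c₁ := by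
  obtain ⟨c₁, hc₁, h311⟩ := lemma311_of_window (k := k) hε hm₀ h38 h310 h39
  refine ⟨c₁, hc₁, fun n hn => ?_⟩
  by_contra hlt
  push Not at hlt
  set q₀ : unitInterval := criticalProbIOf (slabGraph 3 k) (slabOrigin 3 k) with hq₀
  have hq₀val : (q₀ : ℝ) = criticalProb (slabGraph 3 k) (slabOrigin 3 k) := rfl
  -- continuity: the strict inequality persists on a neighbourhood of `q₀`
  set g : unitInterval → ℝ := fun p => crossingProb k p (2 * n) (n - 1) with hg
  have hcont : Continuous g := continuous_crossingProb _ _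
  have hopen : IsOpen {p : unitInterval | 1 - c₁ < g p} := isOpen_lt continuous_const hcont
  have hmem : q₀ ∈ {p : unitInterval | 1 - c₁ < g p} := hlt
  obtain ⟨r, hr, hball⟩ := Metric.isOpen_iff.1 hopen q₀ hmem
  -- a point strictly below `q₀`, still `≥ ε`, in the ball
  set δ : ℝ := min (r / 2) ((criticalProb (slabGraph 3 k) (slabOrigin 3 k) - ε) / 2) with hδ
  have hδ0 : 0 < δ := lt_min (by linarith) (by linarith)
  have hδr : δ < r := lt_of_le_of_lt (min_le_left _ _) (by linarith)
  have hδε : δ ≤ (criticalProb (slabGraph 3 k) (slabOrigin 3 k) - ε) / 2 := min_le_right _ _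
  have hq01 : (q₀ : ℝ) - δ ∈ unitInterval := by
    refine ⟨by rw [hq₀val]; linarith, ?_⟩
    have := q₀.2.2
    linarith
  set q : unitInterval := ⟨(q₀ : ℝ) - δ, hq01⟩ with hq
  have hqball : q ∈ Metric.ball q₀ r := by
    rw [Metric.mem_ball, Subtype.dist_eq, Real.dist_eq]
    show |(q₀ : ℝ) - δ - q₀| < r
    rw [show (q₀ : ℝ) - δ - q₀ = -δ by ring, abs_neg, abs_of_pos hδ0]; exact hδr
  have hgq : 1 - c₁ < g q := hball hqball
  have hqε : ε ≤ (q : ℝ) := by show ε ≤ (q₀ : ℝ) - δ; rw [hq₀val]; linarith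
  have hq1 : (q : ℝ) ≤ 1 - ε := by show (q₀ : ℝ) - δ ≤ 1 - ε; rw [hq₀val]; linarith
  -- Lemma 3.11 at `q`: `θ(q) > 0`, so `p_c ≤ q < p_c`
  have hθ := h311 q hqε hq1 n hn hgq.le
  have hle := criticalProb_le_of_theta_pos (slabGraph 3 k) (slabOrigin 3 k) q hθ
  have : (q : ℝ) < criticalProb (slabGraph 3 k) (slabOrigin 3 k) := by
    show (q₀ : ℝ) - δ < _; rw [hq₀val]; linarith
  linarith

/-! ## The upper bound (3.60) at `p_c(S_k)` -/

/-- **NTW 2017, §3.7, eq. (3.60) at `p_c(S_k)`: `sup_n f(n,2n) < 1`**, in the form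
`∃ c₂ > 0, ∀ n ≥ 1, f_{p_c(S_k)}(n, 2n) ≤ 1 - c₂` — from Lemma 3.13 (i) (via the inputs of Lemma 3.11)
and (H317): at `p_c(S_k)`, `sup_n f(n,2n) = 1 ⟹ sup_{n ≥ m₀} f(2n, n-1) = 1` (Theorem 3.17 with the
Prop. 3.9 step of §3.7).  This is the input `(H360)` of `Crossing.NewmanTassionWu2017_thm31_of`.
[cite: NewmanTassionWu2017, §3.7 eq. (3.60)] -/
theorem h360_of_window {ε : ℝ} (hε : 0 < ε) {m₀ : ℕ} (hm₀ : 1 ≤ m₀)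
    (hεc : ε < criticalProb (slabGraph 3 k) (slabOrigin 3 k))
    (hc1 : criticalProb (slabGraph 3 k) (slabOrigin 3 k) ≤ 1 - ε)
    (h38 : ∀ η : ℝ, 0 < η → ∃ δ : ℝ, 0 < δ ∧ ∀ p : unitInterval, ε ≤ (p : ℝ) → (p : ℝ) ≤ 1 - ε →
      ∀ m n : ℕ, m₀ ≤ m → m ≤ n → ∀ (z : ℤ × ℤ) (i : Fin 2),
      1 - δ ≤ crossingProb k p (3 * n) (2 * m) →
      1 - δ ≤ (bondPercolation (slabGraph 3 k) p).real (circuitAround k z m n) →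
      1 - δ ≤ (bondPercolation (slabGraph 3 k) p).real (circuitAround k (z + coarseShift (3 * n) i) m n) →
      1 - η ≤ (bondPercolation (slabGraph 3 k) p).real (linkEvent' k z m n i))
    (h310 : ∀ c : ℝ, 0 < c → ∃ lam : ℕ, 1 ≤ lam ∧ ∃ c' : ℝ, 0 < c' ∧ ∀ p : unitInterval,
      ε ≤ (p : ℝ) → (p : ℝ) ≤ 1 - ε → ∀ n : ℕ, m₀ ≤ n → c ≤ crossingProb k p (2 * n) (n - 1) →
      ∀ z : ℤ × ℤ, c' ≤ (bondPercolation (slabGraph 3 k) p).real (circuitAround k z (lam * n) (2 * (lam * n))))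
    (h39 : ∀ η : ℝ, 0 < η → ∀ j : ℕ, 1 ≤ j → ∃ δ : ℝ, 0 < δ ∧ ∀ p : unitInterval,
      ε ≤ (p : ℝ) → (p : ℝ) ≤ 1 - ε → ∀ m : ℕ, m₀ ≤ m →
      1 - δ ≤ crossingProb k p (2 * m) (m - 1) → 1 - η ≤ crossingProb k p (j * m) (m - 1))
    (h317 : ∀ η : ℝ, 0 < η →
      (∀ δ : ℝ, 0 < δ → ∃ n : ℕ, 1 ≤ n ∧
        1 - δ ≤ crossingProb k (criticalProbIOf (slabGraph 3 k) (slabOrigin 3 k)) n (2 * n)) →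
      ∃ n : ℕ, m₀ ≤ n ∧
        1 - η ≤ crossingProb k (criticalProbIOf (slabGraph 3 k) (slabOrigin 3 k)) (2 * n) (n - 1)) :
    ∃ c₂ : ℝ, 0 < c₂ ∧ ∀ n : ℕ, 1 ≤ n →
      crossingProb k (criticalProbIOf (slabGraph 3 k) (slabOrigin 3 k)) n (2 * n) ≤ 1 - c₂ := by
  obtain ⟨c₁, hc₁, h313⟩ := lemma313_i_of_window (k := k) hε hm₀ hεc hc1 h38 h310 h39
  by_contra hno
  push Not at hno
  -- `sup_n f(n, 2n) = 1`
  have hsup : ∀ δ : ℝ, 0 < δ → ∃ n : ℕ, 1 ≤ n ∧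
      1 - δ ≤ crossingProb k (criticalProbIOf (slabGraph 3 k) (slabOrigin 3 k)) n (2 * n) := by
    intro δ hδ
    obtain ⟨n, hn, hlt⟩ := hno δ hδ
    exact ⟨n, hn, hlt.le⟩
  obtain ⟨n, hn, hge⟩ := h317 (c₁ / 2) (by linarith) hsup
  have := h313 n hn
  linarith

/-- **(3.60) at `p_c(S_k)` from THREE inputs** — (H310), (H39) on `[ε, 1-ε]` and (H317) at `p_c(S_k)` — the
gluing of minimal circuits (H38) being a theorem (`h38_window`).  (`m₀ ≥ 1`.)
[cite: NewmanTassionWu2017, §3.7 eq. (3.60) with Theorem 3.8] -/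
theorem h360_of_three_inputs {ε : ℝ} (hε : 0 < ε) {m₀ : ℕ} (hm₀ : 1 ≤ m₀)
    (hεc : ε < criticalProb (slabGraph 3 k) (slabOrigin 3 k))
    (hc1 : criticalProb (slabGraph 3 k) (slabOrigin 3 k) ≤ 1 - ε)
    (h310 : ∀ c : ℝ, 0 < c → ∃ lam : ℕ, 1 ≤ lam ∧ ∃ c' : ℝ, 0 < c' ∧ ∀ p : unitInterval,
      ε ≤ (p : ℝ) → (p : ℝ) ≤ 1 - ε → ∀ n : ℕ, m₀ ≤ n → c ≤ crossingProb k p (2 * n) (n - 1) →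
      ∀ z : ℤ × ℤ, c' ≤ (bondPercolation (slabGraph 3 k) p).real (circuitAround k z (lam * n) (2 * (lam * n))))
    (h39 : ∀ η : ℝ, 0 < η → ∀ j : ℕ, 1 ≤ j → ∃ δ : ℝ, 0 < δ ∧ ∀ p : unitInterval,
      ε ≤ (p : ℝ) → (p : ℝ) ≤ 1 - ε → ∀ m : ℕ, m₀ ≤ m →
      1 - δ ≤ crossingProb k p (2 * m) (m - 1) → 1 - η ≤ crossingProb k p (j * m) (m - 1))
    (h317 : ∀ η : ℝ, 0 < η →
      (∀ δ : ℝ, 0 < δ → ∃ n : ℕ, 1 ≤ n ∧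
        1 - δ ≤ crossingProb k (criticalProbIOf (slabGraph 3 k) (slabOrigin 3 k)) n (2 * n)) →
      ∃ n : ℕ, m₀ ≤ n ∧
        1 - η ≤ crossingProb k (criticalProbIOf (slabGraph 3 k) (slabOrigin 3 k)) (2 * n) (n - 1)) :
    ∃ c₂ : ℝ, 0 < c₂ ∧ ∀ n : ℕ, 1 ≤ n →
      crossingProb k (criticalProbIOf (slabGraph 3 k) (slabOrigin 3 k)) n (2 * n) ≤ 1 - c₂ := by
  refine h360_of_window (k := k) hε hm₀ hεc hc1 (fun η hη => ?_) h310 h39 h317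
  obtain ⟨δ, hδ, H⟩ := h38_window k hε hη
  exact ⟨δ, hδ, fun p hpε hp1 m n hm hmn z i hf h1 h2 => H p hpε hp1 m n (hm₀.trans hm) hmn z i hf h1 h2⟩

end NTW17

end Literature.Probability.Percolation

end
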